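import Summits.SmoothPoincare4.SmoothPoincare4.Theses.SymplecticOrigami
import Literature.AlgebraicTopology.SingularHomology.CechDualityCompact
import Literature.Geometry.Symplectic.ThomGysinComplementSurfaceFour
import Literature.AlgebraicTopology.SingularHomology.PoincareDualityCorollaries
import Literature.AlgebraicTopology.SingularHomology.CompactManifoldFiniteness
import Literature.AlgebraicTopology.SingularHomology.OrientationProofs
import Literature.AlgebraicTopology.SingularHomology.FundamentalClassExistence
import Literature.AlgebraicTopology.SingularHomology.FundamentalClassProofs

/-!
# Stub `stub_pinch_pieceLES` of line `pair-rigidity-endgame` (crux `SymplecticOrigami.OrigamiRung`)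

**The exact sequence of the piece, with field coefficients.**  `N` is a closed connected
`ℤ`-oriented `4`-manifold, `S` a compact connected `ℤ`-oriented surface, `b : S → N` a smooth
embedding with image `B = b(S)`, and `X = N ∖ B` (the subtype `↥(range b)ᶜ`).  Then
`H₁(X; ℤ)` is finitely generated, and for every field `F`: all `H_k(X; F)` are
finite-dimensional, `h₁(N) ≤ h₁(X) ≤ h₁(N) + 1`, and
`h₂(X) + 2 h₁(N) + 1 = h₁(S) + h₂(N) + h₁(X) + h₃(X)` (A. Hatcher, *Algebraic Topology* (2002),
Thm. 2.16 — the exact sequence of the pair `(N, X)` — with Prop. 3.46 / H. Miller, *Lectures on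
Algebraic Topology* (2020), Thm. 37.1 — Čech–Alexander–Poincaré duality
`H_q(N, N ∖ B) ≅ Ȟ^{4-q}(B)` — and Thm. 3.26, Cor. 3.37 on `N` and `S`).

Proof, over the tree's PROVED singular-homology library (no tubular neighbourhood, no Thom
isomorphism):

* `H_q(N, X; F) ≅ Ȟᵖ(B; F) ≅ Hᵖ(↥B; F) ≅ Hᵖ(S; F) ≅ Hom_F(H_p(S; F), F)` for `p + q = 4`
  (`CechDuality.classAlong_of_isCompact` for the `F`-orientation `μ ⊗ F`
  (`HomologicalOrientation.toCoeff`); tautness `Cech.RetractionNhds.cechEquiv` of the compact,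
  locally contractible `B ≅ S` inside `N`, a Euclidean neighbourhood retract after an embedding
  `N ↪ ℝᵐ` (`exists_isClosedEmbedding_pi_of_compactSpace`,
  `isNeighbourhoodRetract_range_of_compactSpace`) — the pattern of
  `Literature/Topology/FourManifolds/ComplexProjectiveSpaceCohomology.lean` and of
  `Literature/Geometry/Symplectic/ThomGysinComplementSurfaceFour.lean`; universal coefficients
  over a field `kroneckerPairing_bijective_of_field`), of dimensions `1, h₁(S), 1, 0` for
  `q = 4, 3, 2, 1` (`H₀(S) ≅ F`, `H₂(S; F) ≅ F`, `H₃(S) = 0`: Prop. 2.7, Thm. 3.26), and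
  `H_q(N, X; F) = 0` for `q > 4` (Lemma 3.27(b), `clocalHomology.ptDetermined_of_isCompact_univ`);
* `h₄(N; F) = 1` (Thm. 3.26), `h₃(N; F) = h₁(N; F)` (Cor. 3.37,
  `bettiNumber_eq_bettiNumber_of_add_eq_holds`), and `j_* : H₄(N) → H₄(N, X)` is injective
  because its composite with the restriction to a point `x ∈ B` is `H₄(N) → H₄(N | x)`,
  injective on a closed connected manifold (Thm. 3.26(b),
  `singularHomology.toLocal_injective_of_connectedSpace_holds`);
* rank bookkeeping in the exact sequence
  `H₄N ↪ H₄(N,X) → H₃X → H₃N → H₃(N,X) → H₂X → H₂N → H₂(N,X) → H₁X → H₁N → H₁(N,X) = 0`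
  (`PinchPiece.bookkeeping`: each term has dimension = rank in + rank out; `omega`), and
  finiteness of every `H_k(X; F)` as the middle term of `H_{k+1}(N, X) → H_k(X) → H_k(N)`;
* over `ℤ`: the tree's Thom–Gysin sequence of the complement
  (`thomGysin_complement_surface_four_holds`: `H₁(X; ℤ) → H₁(N; ℤ)` onto with kernel the image
  of `ℤ`) and finiteness of `H₁(N; ℤ)` (`finite_singularHomology_of_compactSpace_holds`).

Everything is proved; all folklore.
-/

noncomputable section

-- the prescribed namespace `Summit.<P>.<Sub>.…` duplicates `SmoothPoincare4` (P = Sub)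
set_option linter.dupNamespace false

open scoped Manifold ContDiff Topology ContinuousMap
open Set TopologicalSpace

namespace Summit.SmoothPoincare4.SmoothPoincare4.Theorems.OrigamiRung.PairRigidityEndgame

open CategoryTheory CategoryTheory.Limits
open Literature.AlgebraicTopology.SingularHomology Literature.AlgebraicTopology.Homotopy

/-- Model space `ℝⁿ`. -/
local notation "𝔼" n:arg => EuclideanSpace ℝ (Fin n)

namespace PinchPiece

/-! ### Linear algebra of exact sequences -/

section Exact

/-- **The middle term of an exact sequence `X₁ → X₂ → X₃` over a Noetherian ring with finitely
generated outer terms is finitely generated.** [folklore] -/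
theorem finite_of_exact {A : Type} [CommRing A] [IsNoetherianRing A] {X₁ X₂ X₃ : ModuleCat.{0} A}
    (f : X₁ ⟶ X₂) (g : X₂ ⟶ X₃) (w : f ≫ g = 0) (h : (ShortComplex.mk f g w).Exact)
    [Module.Finite A X₁] [Module.Finite A X₃] : Module.Finite A X₂ := by
  -- adapted from `Literature.Algebra.Homology.OrderedCech.moduleFinite_mid_of_exact`
  have hker : LinearMap.range f.hom = LinearMap.ker g.hom := h.moduleCat_range_eq_ker
  refine Module.Finite.of_fg_top (Submodule.fg_of_fg_map_of_fg_inf_ker g.hom ?_ ?_)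
  · exact IsNoetherian.noetherian _
  · rw [top_inf_eq, ← hker, LinearMap.range_eq_map]
    exact (Module.Finite.fg_top (R := A) (M := X₁)).map f.hom

variable (F : Type) [Field F]

/-- **Rank count at the middle of an exact sequence** of finite-dimensional vector spaces:
`dim X₂ = rk f + rk g` for `X₁ → X₂ → X₃` exact at `X₂` (rank–nullity). [folklore] -/
theorem finrank_eq_rk_add_rk {X₁ X₂ X₃ : ModuleCat.{0} F} (f : X₁ ⟶ X₂) (g : X₂ ⟶ X₃)
    (w : f ≫ g = 0) (h : (ShortComplex.mk f g w).Exact) [Module.Finite F X₂] :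
    Module.finrank F X₂ =
      Module.finrank F (LinearMap.range f.hom) + Module.finrank F (LinearMap.range g.hom) := by
  have hker : LinearMap.range f.hom = LinearMap.ker g.hom := h.moduleCat_range_eq_ker
  rw [← LinearMap.finrank_range_add_finrank_ker g.hom, ← hker, add_comm]

/-- **The arithmetic of the bookkeeping**: with `nₖ = dim H_k(Y)`, `aₖ = dim H_k(A)`,
`ρₖ = dim H_k(Y, A)` and `iₖ, jₖ, dₖ` the ranks of `i_*`, `j_*`, `∂` in the exact sequence of the
pair (each term = rank in + rank out), `j₁ = 0`, `j₄ = n₄ = 1`, `ρ₂ = ρ₄ = 1`, `n₃ = n₁` give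
`n₁ ≤ a₁ ≤ n₁ + 1` and `a₂ + 2n₁ + 1 = ρ₃ + n₂ + a₁ + a₃`. [folklore] -/
theorem rank_arith {n₁ n₂ n₃ n₄ a₁ a₂ a₃ ρ₂ ρ₃ ρ₄ i₁ i₂ i₃ j₁ j₂ j₃ j₄ d₁ d₂ d₃ : ℕ}
    (h2 : ρ₂ = 1) (h4 : ρ₄ = 1) (hn4 : n₄ = 1) (h31 : n₃ = n₁)
    (eN1 : n₁ = i₁ + j₁) (eN2 : n₂ = i₂ + j₂) (eN3 : n₃ = i₃ + j₃)
    (eA1 : a₁ = d₁ + i₁) (eA2 : a₂ = d₂ + i₂) (eA3 : a₃ = d₃ + i₃)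
    (eR2 : ρ₂ = j₂ + d₁) (eR3 : ρ₃ = j₃ + d₂) (eR4 : ρ₄ = j₄ + d₃)
    (ej4 : j₄ = n₄) (ej1 : j₁ = 0) :
    n₁ ≤ a₁ ∧ a₁ ≤ n₁ + 1 ∧ a₂ + 2 * n₁ + 1 = ρ₃ + n₂ + a₁ + a₃ := by
  omega

end Exact

/-! ### The exact sequence of a pair, as rank counts -/

section Pair

variable (F : Type) [Field F] {Y : Type} [TopologicalSpace Y] (A : Set Y)

/-- `dim H_k(Y) = rk i_* + rk j_*` (exactness of `H_k(A) → H_k(Y) → H_k(Y, A)`, Hatcher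
Thm. 2.16). [folklore] -/
theorem finrank_abs_eq (k : ℕ) [Module.Finite F (singularHomology F F Y k)] :
    Module.finrank F (singularHomology F F Y k) =
      Module.finrank F (LinearMap.range (singularHomology.map F F (subsetIncl A) k).hom) +
        Module.finrank F (LinearMap.range (relativeSingularHomology.ofAbsolute F F Y A k).hom) :=
  finrank_eq_rk_add_rk F _ _ _ (relativeSingularHomology.exact_map_ofAbsolute F F A k)

/-- `dim H_{k+1}(Y, A) = rk j_* + rk ∂` (exactness of `H_{k+1}(Y) → H_{k+1}(Y, A) → H_k(A)`).
[folklore] -/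
theorem finrank_rel_eq (k : ℕ) [Module.Finite F (relativeSingularHomology F F Y A (k + 1))] :
    Module.finrank F (relativeSingularHomology F F Y A (k + 1)) =
      Module.finrank F
          (LinearMap.range (relativeSingularHomology.ofAbsolute F F Y A (k + 1)).hom) +
        Module.finrank F (LinearMap.range (relativeSingularHomology.δ F F Y A k).hom) :=
  finrank_eq_rk_add_rk F _ _ _ (relativeSingularHomology.exact_ofAbsolute_δ F F A k)

/-- `dim H_k(A) = rk ∂ + rk i_*` (exactness of `H_{k+1}(Y, A) → H_k(A) → H_k(Y)`). [folklore] -/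
theorem finrank_sub_eq (k : ℕ) [Module.Finite F (singularHomology F F ↥A k)] :
    Module.finrank F (singularHomology F F ↥A k) =
      Module.finrank F (LinearMap.range (relativeSingularHomology.δ F F Y A k).hom) +
        Module.finrank F (LinearMap.range (singularHomology.map F F (subsetIncl A) k).hom) :=
  finrank_eq_rk_add_rk F _ _ _ (relativeSingularHomology.exact_δ_map F F A k)

/-- `H_k(A)` is finite-dimensional once `H_{k+1}(Y, A)` and `H_k(Y)` are. [folklore] -/
theorem finite_sub (k : ℕ) [Module.Finite F (relativeSingularHomology F F Y A (k + 1))]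
    [Module.Finite F (singularHomology F F Y k)] : Module.Finite F (singularHomology F F ↥A k) :=
  finite_of_exact _ _ _ (relativeSingularHomology.exact_δ_map F F A k)

/-- **Rank bookkeeping in the exact sequence of a pair `(Y, A)` shaped like
`(N⁴, N ∖ surface)`**: if all `H_k(Y)` and `H_{k+1}(Y, A)` are finite-dimensional,
`dim H_q(Y, A) = 0, 1, ·, 1` for `q = 1, 2, 3, 4`, `dim H₄(Y) = 1`, `j_* : H₄(Y) → H₄(Y, A)` is
injective and `dim H₃(Y) = dim H₁(Y)`, then every `H_k(A)` is finite-dimensional,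
`h₁(Y) ≤ h₁(A) ≤ h₁(Y) + 1` and `h₂(A) + 2h₁(Y) + 1 = dim H₃(Y, A) + h₂(Y) + h₁(A) + h₃(A)`
(every term of `H₄Y ↪ H₄(Y,A) → H₃A → ⋯ → H₁A → H₁Y → H₁(Y,A) = 0` has dimension rank in plus
rank out, `rank_arith`). [folklore] -/
theorem bookkeeping (hY : ∀ k, Module.Finite F (singularHomology F F Y k))
    (hR : ∀ k, Module.Finite F (relativeSingularHomology F F Y A (k + 1)))
    (h1 : Module.finrank F (relativeSingularHomology F F Y A 1) = 0)
    (h2 : Module.finrank F (relativeSingularHomology F F Y A 2) = 1)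
    (h4 : Module.finrank F (relativeSingularHomology F F Y A 4) = 1)
    (hY4 : Module.finrank F (singularHomology F F Y 4) = 1)
    (hj4 : Function.Injective (relativeSingularHomology.ofAbsolute F F Y A 4))
    (h31 : Module.finrank F (singularHomology F F Y 3) =
      Module.finrank F (singularHomology F F Y 1)) :
    (∀ k, Module.Finite F (singularHomology F F ↥A k)) ∧
      Module.finrank F (singularHomology F F Y 1) ≤ Module.finrank F (singularHomology F F ↥A 1) ∧
      Module.finrank F (singularHomology F F ↥A 1) ≤
        Module.finrank F (singularHomology F F Y 1) + 1 ∧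
      Module.finrank F (singularHomology F F ↥A 2) +
          2 * Module.finrank F (singularHomology F F Y 1) + 1 =
        Module.finrank F (relativeSingularHomology F F Y A 3) +
          Module.finrank F (singularHomology F F Y 2) +
          Module.finrank F (singularHomology F F ↥A 1) +
          Module.finrank F (singularHomology F F ↥A 3) := by
  have hA : ∀ k, Module.Finite F (singularHomology F F ↥A k) := fun k =>
    haveI := hY k; haveI := hR k; finite_sub F A k
  haveI := hY 1; haveI := hY 2; haveI := hY 3
  haveI := hA 1; haveI := hA 2; haveI := hA 3
  haveI := hR 1; haveI := hR 2; haveI := hR 3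
  haveI : Module.Finite F (relativeSingularHomology F F Y A 1) := hR 0
  -- the two ends: `j_*` injective in degree `4`, `H₁(Y, A) = 0`
  have ej4 : Module.finrank F
      (LinearMap.range (relativeSingularHomology.ofAbsolute F F Y A 4).hom) =
        Module.finrank F (singularHomology F F Y 4) := LinearMap.finrank_range_of_inj hj4
  have ej1 : Module.finrank F
      (LinearMap.range (relativeSingularHomology.ofAbsolute F F Y A 1).hom) = 0 :=
    Nat.eq_zero_of_le_zero ((Submodule.finrank_le _).trans h1.le)
  exact ⟨hA, rank_arith h2 h4 hY4 h31 (finrank_abs_eq F A 1) (finrank_abs_eq F A 2)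
    (finrank_abs_eq F A 3) (finrank_sub_eq F A 1) (finrank_sub_eq F A 2) (finrank_sub_eq F A 3)
    (finrank_rel_eq F A 1) (finrank_rel_eq F A 2) (finrank_rel_eq F A 3) ej4 ej1⟩

end Pair

/-! ### Over `ℤ`: finiteness of `H₁` of the complement -/

/-- **`H₁(N ∖ b(S); ℤ)` is finitely generated** for a closed oriented surface smoothly embedded in
a closed oriented `4`-manifold: in the Thom–Gysin sequence of the complement
(`thomGysin_complement_surface_four_holds`) `H₁(N ∖ S) → H₁(N)` is onto with kernel the image of
`ℤ`, and `H₁(N; ℤ)` is finitely generated (`finite_singularHomology_of_compactSpace_holds`).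
[folklore] -/
theorem finite_singularHomology_one_compl_int (N : Type) [TopologicalSpace N] [T2Space N]
    [SecondCountableTopology N] [CompactSpace N] [ChartedSpace (𝔼 4) N] [IsManifold (𝓡 4) ∞ N]
    (μ : HomologicalOrientation ℤ N 4) (S : Type) [TopologicalSpace S] [CompactSpace S]
    [ConnectedSpace S] [ChartedSpace (𝔼 2) S] [IsManifold (𝓡 2) ∞ S]
    (μS : HomologicalOrientation ℤ S 2) (b : S → N)
    (hb : Manifold.IsSmoothEmbedding (𝓡 2) (𝓡 4) ∞ b) :
    Module.Finite ℤ (singularHomology ℤ ℤ ↥(Set.range b)ᶜ 1) := by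
  have hPD : Function.Bijective (poincareDualityMap μ two_add_two_eq_four) :=
    poincare_duality μ two_add_two_eq_four
  obtain ⟨σ, hσ⟩ :=
    hPD.2 (singularHomology.map ℤ ℤ ⟨b, hb.isEmbedding.continuous⟩ 2 μS.fundamentalClass)
  obtain ⟨-, δ, hrange, -⟩ :=
    Literature.Geometry.Symplectic.thomGysin_complement_surface_four_holds N μ S μS b hb σ hσ
  haveI : Module.Finite ℤ (singularHomology ℤ ℤ N 1) :=
    finite_singularHomology_of_compactSpace_holds ℤ N 4 1
  refine Module.Finite.of_fg_top (Submodule.fg_of_fg_map_of_fg_inf_ker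
    (singularHomology.map ℤ ℤ
      (⟨Subtype.val, continuous_subtype_val⟩ : C(↥(Set.range b)ᶜ, N)) 1).hom ?_ ?_)
  · exact IsNoetherian.noetherian _
  · rw [top_inf_eq, ← hrange, LinearMap.range_eq_map]
    exact (Module.Finite.fg_top (R := ℤ) (M := ℤ)).map δ

end PinchPiece

open PinchPiece in
/-- **Stub P4 — the exact sequence of the piece, with field coefficients (N-side).**  Let `N` be
a closed connected `ℤ`-oriented 4-manifold, `S` a compact connected `ℤ`-oriented surface,
`b : S → N` a smooth embedding, `X = N ∖ b(S)` (as the subtype `↥(range b)ᶜ`).  Then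
`H₁(X; ℤ)` is finitely generated, and for every field `F`: all `H_k(X; F)` are
finite-dimensional, `h₁(N) ≤ h₁(X) ≤ h₁(N) + 1`, and
`h₂(X) + 2 h₁(N) + 1 = h₁(S) + h₂(N) + h₁(X) + h₃(X)`: the exact sequence of the pair `(N, X)`
with `H_q(N, X; F) ≅ Ȟ^{4-q}(B; F) ≅ H^{4-q}(S; F)` (Čech duality along the compact `B = b(S)`,
tautness of `B` in the Euclidean neighbourhood retract `N`, universal coefficients over `F`) of
dimensions `1, h₁(S), 1, 0` for `q = 4, 3, 2, 1` and `0` for `q > 4`, `h₄(N) = 1`,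
`h₃(N) = h₁(N)`, `H₄(N) ↪ H₄(N, X)` (it factors `H₄(N) ↪ H₄(N | x)`, `x ∈ B`), then rank
bookkeeping (`PinchPiece.bookkeeping`); over `ℤ` the Thom–Gysin sequence of the complement.
[folklore] -/
theorem stub_pinch_pieceLES :
    ∀ (N : Type) [TopologicalSpace N] [T2Space N] [SecondCountableTopology N] [CompactSpace N]
      [ConnectedSpace N] [ChartedSpace (𝔼 4) N] [IsManifold (𝓡 4) ∞ N]
      (S : Type) [TopologicalSpace S] [CompactSpace S] [ConnectedSpace S] [ChartedSpace (𝔼 2) S]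
      [IsManifold (𝓡 2) ∞ S] (b : S → N),
      Nonempty (HomologicalOrientation ℤ N 4) → Nonempty (HomologicalOrientation ℤ S 2) →
      Manifold.IsSmoothEmbedding (𝓡 2) (𝓡 4) ∞ b →
      Module.Finite ℤ (singularHomology ℤ ℤ ↥(Set.range b)ᶜ 1) ∧
      ∀ (F : Type) [Field F],
        (∀ k, Module.Finite F (singularHomology F F ↥(Set.range b)ᶜ k)) ∧
        Module.finrank F (singularHomology F F N 1) ≤
          Module.finrank F (singularHomology F F ↥(Set.range b)ᶜ 1) ∧
        Module.finrank F (singularHomology F F ↥(Set.range b)ᶜ 1) ≤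
          Module.finrank F (singularHomology F F N 1) + 1 ∧
        Module.finrank F (singularHomology F F ↥(Set.range b)ᶜ 2) +
            2 * Module.finrank F (singularHomology F F N 1) + 1 =
          Module.finrank F (singularHomology F F S 1) + Module.finrank F (singularHomology F F N 2) +
            Module.finrank F (singularHomology F F ↥(Set.range b)ᶜ 1) +
            Module.finrank F (singularHomology F F ↥(Set.range b)ᶜ 3) := by
  intro N _ _ _ _ _ _ _ S _ _ _ _ _ b hμ hμS hb
  obtain ⟨μ⟩ := hμ
  obtain ⟨μS⟩ := hμS
  -- ### the compact set `B = b(S)`, homeomorphic to `S`, taut in `N`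
  have hbe : Topology.IsEmbedding b := hb.isEmbedding
  haveI : T2Space S := hbe.t2Space
  have hBc : IsCompact (Set.range b) := isCompact_range hbe.continuous
  have hBne : (Set.range b).Nonempty := Set.range_nonempty b
  obtain ⟨m, ι, hιc⟩ :=
    Literature.Geometry.Manifold.exists_isClosedEmbedding_pi_of_compactSpace (𝔼 4) (M := N)
  have hNR : IsNeighbourhoodRetract (Set.range ι) :=
    isNeighbourhoodRetract_range_of_compactSpace
      isNeighbourhoodRetract_of_locallyContractibleSpace_holds (𝔼 4) hιc.isEmbedding
  have hKl : LocallyContractibleSpace ↥(Set.range b) :=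
    locallyContractibleSpace_of_homeomorph hbe.toHomeomorph
      (locallyContractibleSpace_of_chartedSpace (𝔼 2))
  obtain ⟨T⟩ := Cech.RetractionNhds.nonempty_of_locallyContractibleSpace (K := Set.range b)
    hιc.isEmbedding hNR hBc hKl
  refine ⟨finite_singularHomology_one_compl_int N μ S μS b hb, fun F _ => ?_⟩
  -- ### field coefficients: the `F`-orientations `μ ⊗ F`
  let μF : HomologicalOrientation F N 4 := μ.toCoeff F
  let μSF : HomologicalOrientation F S 2 := μS.toCoeff F
  have hNfin : ∀ k, Module.Finite F (singularHomology F F N k) := fun k =>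
    finite_singularHomology_of_compactSpace_holds F N 4 k
  have hSfin : ∀ k, Module.Finite F (singularHomology F F S k) := fun k =>
    finite_singularHomology_of_compactSpace_holds F S 2 k
  -- ### `H_q(N, X; F) ≃ Ȟᵖ(B) ≃ Hᵖ(↥B) ≃ Hᵖ(S) ≃ Hom(H_p(S), F)` for `p + q = 4`
  have hD := CechDuality.classAlong_of_isCompact (by norm_num : 1 ≤ 4) μF hBc
  have D : ∀ {p q : ℕ}, p + q = 4 →
      (relativeSingularHomology F F N (Set.range b)ᶜ q ≃ₗ[F]
        Module.Dual F (singularHomology F F S p)) := fun {p q} h =>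
    (relativeSingularHomology.concreteIso F F N (Set.range b)ᶜ q).toLinearEquiv ≪≫ₗ
      (LinearEquiv.ofBijective _ (hD p q h)).symm ≪≫ₗ (T.cechEquiv F p) ≪≫ₗ
      (singularCohomology.mapIso F F hbe.toHomeomorph p).toLinearEquiv ≪≫ₗ
      LinearEquiv.ofBijective _ (kroneckerPairing_bijective_of_field F S p)
  have hR : ∀ {p q : ℕ}, p + q = 4 →
      Module.Finite F (relativeSingularHomology F F N (Set.range b)ᶜ q) ∧
        Module.finrank F (relativeSingularHomology F F N (Set.range b)ᶜ q) =
          Module.finrank F (singularHomology F F S p) := by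
    intro p q h
    haveI := hSfin p
    exact ⟨Module.Finite.equiv (D h).symm, by rw [(D h).finrank_eq, Subspace.dual_finrank_eq]⟩
  -- `H_q(N, X; F) = 0` for `q > 4` (Hatcher Lemma 3.27(b))
  have hRtop : ∀ i, 4 < i → IsZero (relativeSingularHomology F F N (Set.range b)ᶜ i) :=
    fun i hi => ((clocalHomology.ptDetermined_of_isCompact_univ F F hBc).1 i hi).of_iso
      (relativeSingularHomology.concreteIso F F N (Set.range b)ᶜ i)
  -- ### homology of the surface: `H₀ ≅ F`, `H₂ ≅ F`, `H₃ = 0`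
  haveI := ChartedSpace.locallyPathConnectedSpace (𝔼 2) S
  haveI : PathConnectedSpace S := pathConnectedSpace_iff_connectedSpace.mpr inferInstance
  haveI := singularHomology.isIso_ε_of_pathConnectedSpace F F (X := S)
  have hS0 : Module.finrank F (singularHomology F F S 0) = 1 := by
    rw [((asIso (singularHomology.ε F F S)).toLinearEquiv.trans ULift.moduleEquiv).finrank_eq,
      Module.finrank_self]
  have hS2 : Module.finrank F (singularHomology F F S 2) = 1 := by
    obtain ⟨e₂⟩ := nonempty_singularHomology_top_iso_holds (R := F) (X := S) 2 μSF
    rw [(e₂.toLinearEquiv.trans ULift.moduleEquiv).finrank_eq, Module.finrank_self]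
  have hS3 : Module.finrank F (singularHomology F F S 3) = 0 := by
    haveI := ModuleCat.subsingleton_of_isZero
      (isZero_singularHomology_of_lt_holds F F S 2 (show 2 < 3 by norm_num))
    exact Module.finrank_zero_of_subsingleton
  -- ### homology of `N`: `h₄ = 1`, `h₃ = h₁`, `H₄(N) ↪ H₄(N, X)`
  have hN4 : Module.finrank F (singularHomology F F N 4) = 1 := by
    obtain ⟨e₄⟩ := nonempty_singularHomology_top_iso_holds (R := F) (X := N) 4 μF
    rw [(e₄.toLinearEquiv.trans ULift.moduleEquiv).finrank_eq, Module.finrank_self]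
  have hN31 : Module.finrank F (singularHomology F F N 3) =
      Module.finrank F (singularHomology F F N 1) :=
    bettiNumber_eq_bettiNumber_of_add_eq_holds F N 4 ⟨μF⟩ (show 3 + 1 = 4 by norm_num)
  have hj4 : Function.Injective
      (relativeSingularHomology.ofAbsolute F F N (Set.range b)ᶜ 4) := by
    obtain ⟨x, hx⟩ := hBne
    intro c c' hcc'
    apply singularHomology.toLocal_injective_of_connectedSpace_holds F F N 4 x
    change singularHomology.toLocalOfSet F F N (Set.range b) 4 c =
      singularHomology.toLocalOfSet F F N (Set.range b) 4 c' at hcc'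
    have key := congrArg (restrictToPoint F F hx 4) hcc'
    rwa [singularHomology.restrictToPoint_toLocalOfSet,
      singularHomology.restrictToPoint_toLocalOfSet] at key
  -- ### finiteness of all `H_{k+1}(N, X; F)` and the bookkeeping
  have hRfin : ∀ k, Module.Finite F (relativeSingularHomology F F N (Set.range b)ᶜ (k + 1))
    | 0 => (hR (p := 3) (q := 1) (by norm_num)).1
    | 1 => (hR (p := 2) (q := 2) (by norm_num)).1
    | 2 => (hR (p := 1) (q := 3) (by norm_num)).1
    | 3 => (hR (p := 0) (q := 4) (by norm_num)).1
    | k + 4 => by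
        haveI := ModuleCat.subsingleton_of_isZero (hRtop (k + 4 + 1) (by omega))
        infer_instance
  obtain ⟨hAfin, hle, hle', hsum⟩ := bookkeeping F (Set.range b)ᶜ hNfin hRfin
    ((hR (p := 3) (q := 1) (by norm_num)).2.trans hS3)
    ((hR (p := 2) (q := 2) (by norm_num)).2.trans hS2)
    ((hR (p := 0) (q := 4) (by norm_num)).2.trans hS0) hN4 hj4 hN31
  rw [(hR (p := 1) (q := 3) (by norm_num)).2] at hsum
  exact ⟨hAfin, hle, hle', hsum⟩

end Summit.SmoothPoincare4.SmoothPoincare4.Theorems.OrigamiRung.PairRigidityEndgame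

end
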